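import Mathlib
import HarnessLib
import Summits.NavierStokesRegularity.NavierStokesRegularity.Theses.TypeIIInviscidRelaxation
import Literature.Analysis.FluidPDE.TypeIICoreWitness

set_option linter.dupNamespace false

/-!
# Line `anchored_late_columnar_core` for crux `ColumnarCoreExclusion` (stmt-NavierStokesRegularity-1966)

Route `TypeIIInviscidRelaxation`, crux (rank 5): a non-Type-I blow-up whose velocity-maximum core is,
at every level `K` and frequently before `T`, `K⁻¹`-close on `K` core radii to a COLUMNAR profile
(`TypeIICoreWitness IsColumnar ν K u t`) is impossible.

ARCHITECTURE (anchor + local finite horizon; two research stubs, kernel-checked composition):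

* `stub_anchoredLateColumnarWitness` [research · L] — ANCHORING/TIMING. From the crux hypotheses,
  some SINGULAR point `xs` of the blow-up time `T` (no bound on any backward parabolic
  neighbourhood `(T-ρ², T) × B_ρ(xs)`) is covered, at every level `K`, by a LATE level-`K` columnar
  witness: a witness `(t, x₀, L, V, Q, W)` with `xs ∈ B̄(x₀, K L / 4)` (inside the quarter of the
  closeness ball) and `(T - t)·V ≤ K·L` (the blow-up happens within `K` core turnovers `L/V`).
  Content: the witnesses of the hypothesis sit at the running velocity maximum, at uncontrolled
  times and places; the stub says they can be chosen late (turnover clock) and anchored at one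
  singular point (the near-max points `x₁` accumulate at singular points since `‖u(t)‖_∞ → ∞`,
  but the closeness radius `K L` may shrink faster than `x₁(t) → xs` — that is the research).
* `stub_columnarCoreLocalHorizon` [research · XL, print anchor = 2½-D / slowly-varying stability:
  Chemin–Gallagher 2010 (Trans. AMS 362), Chemin–Gallagher–Paicu 2011 (Ann. Math. 173) global
  regularity for data slowly varying in one direction; BKM/2D global regularity of columnar flows]
  — LOCAL FINITE-HORIZON REGULARITY OF NEAR-COLUMNAR CORES: there is a universal level `K₀` such
  that a classical Leray–Hopf solution carrying at time `t` a level-`K ≥ K₀` columnar witness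
  centred at `x₀` with `(T - t)·V ≤ K·L` stays bounded on `[t, T) × B(x₀, K L / 2)`.
  (Scale-free: `ν` enters only through the core Reynolds number `L V / ν ≥ K`.) Why it might
  fail: `K⁻¹`-closeness in `C⁰` does not control sub-core-scale vorticity, and pressure is
  non-local — a genuinely new stability statement at high Reynolds number on a finite horizon.
* `ColumnarCoreExclusion_of` — PROVED composition: the late anchored witness at level `K₀` and the
  local horizon bound give a bound on `(T-ρ², T) × B_ρ(xs)`, `ρ = min (K₀ L/4) √(T-t)`,
  contradicting the singularity of `xs`.

No new definitions; stubs are stated over `Literature.Analysis.FluidPDE.TypeIICoreWitness`,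
`IsColumnar`, `IsMaximalSmoothSolution`, `IsLerayHopfOn`, `HasRapidSpatialDecay`, `IsTypeIBlowup`.
Navier–Stokes regularity is NOT proved by anything here. decomp-ns line-writer g0.
-/

namespace Summit.NavierStokesRegularity.NavierStokesRegularity.Cruxes.ColumnarCoreExclusion.AnchoredLateColumnarCore

open Literature.Analysis.FluidPDE Set Metric

/-- [research · L] **Anchored late columnar witnesses.** Under the hypotheses of the crux
`ColumnarCoreExclusion` (maximal smooth Leray–Hopf solution from rapidly decaying data, not
Type I, columnar core witnesses at every level frequently before `T`), there is a point `xs`,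
SINGULAR at time `T` (unbounded on every backward parabolic neighbourhood), such that for every
level `K > 0` some level-`K` columnar witness `(t, x₀, L, V, Q, W)`, `0 < t < T`, is LATE —
`(T - t)·V ≤ K·L` — and ANCHORED at `xs` — `dist xs x₀ ≤ K·L/4`. -/
theorem stub_anchoredLateColumnarWitness {ν T : ℝ}
    {u : ℝ → EuclideanSpace ℝ (Fin 3) → EuclideanSpace ℝ (Fin 3)}
    {p : ℝ → EuclideanSpace ℝ (Fin 3) → ℝ}
    (hν : 0 < ν) (hT : 0 < T) (hmax : IsMaximalSmoothSolution ν 0 u p T)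
    (hLH : IsLerayHopfOn T ν 0 (u 0) u) (hdec : HasRapidSpatialDecay (u 0))
    (hnI : ¬ IsTypeIBlowup u T)
    (hw : ∀ K : ℝ, 0 < K → ∀ t₀ < T, ∃ t, t₀ < t ∧ t < T ∧ TypeIICoreWitness IsColumnar ν K u t) :
    ∃ xs : EuclideanSpace ℝ (Fin 3),
      (¬ ∃ ρ M : ℝ, 0 < ρ ∧ ∀ s ∈ Ioo (T - ρ ^ 2) T, ∀ x ∈ ball xs ρ, ‖u s x‖ ≤ M) ∧
      ∀ K : ℝ, 0 < K → ∃ t : ℝ, 0 < t ∧ t < T ∧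
        ∃ (x₀ : EuclideanSpace ℝ (Fin 3)) (L V : ℝ)
          (Q : EuclideanSpace ℝ (Fin 3) ≃ₗᵢ[ℝ] EuclideanSpace ℝ (Fin 3))
          (W : EuclideanSpace ℝ (Fin 3) → EuclideanSpace ℝ (Fin 3)),
          0 < L ∧ 0 < V ∧ IsColumnar W ∧ (∀ x, ‖u t x‖ ≤ V) ∧
          (∃ x₁, dist x₁ x₀ ≤ L ∧ V ≤ 2 * ‖u t x₁‖) ∧
          (∃ y y' : EuclideanSpace ℝ (Fin 3), ‖y‖ ≤ 1 ∧ ‖y'‖ ≤ 1 ∧ (4 : ℝ)⁻¹ ≤ ‖W y - W y'‖) ∧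
          K * ν ≤ L * V ∧
          (∀ y : EuclideanSpace ℝ (Fin 3), ‖y‖ ≤ K →
            ‖V⁻¹ • Q.symm (u t (x₀ + L • Q y)) - W y‖ ≤ K⁻¹) ∧
          (T - t) * V ≤ K * L ∧ dist xs x₀ ≤ K * L / 4 := by
  sorry

/-- [research · XL; print anchor: global regularity of flows slowly varying in one direction,
Chemin–Gallagher 2010 / Chemin–Gallagher–Paicu 2011, and 2D (columnar) global regularity]
**Local finite-horizon regularity of near-columnar cores.** There is a universal level `K₀ > 0`
such that: if a classical solution on `[0, T)`, Leray–Hopf from rapidly decaying data, carries at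
a time `0 < t < T` a level-`K` columnar core witness (`K ≥ K₀`: sup `V`, near-maximum within `L`
of `x₀`, core Reynolds number `L V/ν ≥ K`, `K⁻¹`-close on `K` core radii to a non-constant
columnar profile `W` after rescaling) and `T` lies within `K` core turnovers, `(T - t)·V ≤ K·L`,
then `u` is bounded on `[t, T) × B(x₀, K L/2)`. -/
theorem stub_columnarCoreLocalHorizon :
    ∃ K₀ : ℝ, 0 < K₀ ∧ ∀ K : ℝ, K₀ ≤ K →
      ∀ (ν T t : ℝ) (u : ℝ → EuclideanSpace ℝ (Fin 3) → EuclideanSpace ℝ (Fin 3))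
        (p : ℝ → EuclideanSpace ℝ (Fin 3) → ℝ),
        0 < ν → 0 < T → IsClassicalNSSolutionOn (Ico 0 T) ν 0 u p → IsLerayHopfOn T ν 0 (u 0) u →
        HasRapidSpatialDecay (u 0) → 0 < t → t < T →
        ∀ (x₀ : EuclideanSpace ℝ (Fin 3)) (L V : ℝ)
          (Q : EuclideanSpace ℝ (Fin 3) ≃ₗᵢ[ℝ] EuclideanSpace ℝ (Fin 3))
          (W : EuclideanSpace ℝ (Fin 3) → EuclideanSpace ℝ (Fin 3)),
          0 < L → 0 < V → IsColumnar W → (∀ x, ‖u t x‖ ≤ V) →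
          (∃ x₁, dist x₁ x₀ ≤ L ∧ V ≤ 2 * ‖u t x₁‖) →
          (∃ y y' : EuclideanSpace ℝ (Fin 3), ‖y‖ ≤ 1 ∧ ‖y'‖ ≤ 1 ∧ (4 : ℝ)⁻¹ ≤ ‖W y - W y'‖) →
          K * ν ≤ L * V →
          (∀ y : EuclideanSpace ℝ (Fin 3), ‖y‖ ≤ K →
            ‖V⁻¹ • Q.symm (u t (x₀ + L • Q y)) - W y‖ ≤ K⁻¹) →
          (T - t) * V ≤ K * L →
          ∃ M : ℝ, ∀ s ∈ Ico t T, ∀ x ∈ ball x₀ (K * L / 2), ‖u s x‖ ≤ M := by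
  sorry

/-- **Composition (kernel-checked, no sorry outside the stubs):** the two stubs imply the crux
`ColumnarCoreExclusion` BY NAME. The late level-`K₀` columnar witness anchored at the singular
point `xs` and the local horizon bound on `[t, T) × B(x₀, K₀L/2)` bound `u` on the backward
parabolic neighbourhood `(T - ρ², T) × B_ρ(xs)`, `ρ = min (K₀L/4) √(T - t)` — contradicting the
singularity of `xs`. -/
theorem ColumnarCoreExclusion_of :
    Summit.NavierStokesRegularity.NavierStokesRegularity.Theses.TypeIIInviscidRelaxation.ColumnarCoreExclusion := by
  intro ν T hν hT u p hmax hLH hdec hnI hw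
  obtain ⟨K₀, hK₀, hstab⟩ := stub_columnarCoreLocalHorizon
  obtain ⟨xs, hsing, hcov⟩ := stub_anchoredLateColumnarWitness hν hT hmax hLH hdec hnI hw
  obtain ⟨t, ht0, htT, x₀, L, V, Q, W, hL, hV, hcol, hbd, hnear, hosc, hRe, hclose, hlate, hdist⟩ :=
    hcov K₀ hK₀
  obtain ⟨M, hM⟩ := hstab K₀ le_rfl ν T t u p hν hT hmax.1 hLH hdec ht0 htT x₀ L V Q W hL hV hcol
    hbd hnear hosc hRe hclose hlate
  apply hsing
  have hTt : 0 < T - t := sub_pos.2 htT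
  set ρ : ℝ := min (K₀ * L / 4) (Real.sqrt (T - t)) with hρ
  have hρpos : 0 < ρ := lt_min (by positivity) (Real.sqrt_pos.2 hTt)
  have hρsq : ρ ^ 2 ≤ T - t :=
    calc ρ ^ 2 ≤ (Real.sqrt (T - t)) ^ 2 := pow_le_pow_left₀ hρpos.le (min_le_right _ _) 2
      _ = T - t := Real.sq_sqrt hTt.le
  have hρle : ρ ≤ K₀ * L / 4 := min_le_left _ _
  refine ⟨ρ, M, hρpos, fun s hs x hx => hM s ⟨?_, hs.2⟩ x ?_⟩
  · linarith [hs.1]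
  · rw [mem_ball] at hx ⊢
    calc dist x x₀ ≤ dist x xs + dist xs x₀ := dist_triangle _ _ _
      _ < ρ + K₀ * L / 4 := by linarith
      _ ≤ K₀ * L / 4 + K₀ * L / 4 := by linarith
      _ = K₀ * L / 2 := by ring

end Summit.NavierStokesRegularity.NavierStokesRegularity.Cruxes.ColumnarCoreExclusion.AnchoredLateColumnarCore
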